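import Summits.Ventures.HSemireg.AmplificationChainG4Transport
import Summits.Ventures.HSemireg.PerfectComplexChartSpread
import Summits.Ventures.HSemireg.PerfectComplexSigmaDoor
import HarnessLib

/-!
# Venture HSemireg — route (C) at g = 4 with the transfer hypothesis RELOCATED to its PRINTED shape: «an admissible perfect
# complex on the CM fibre deforms, as a perfect complex, over an ÉTALE NEIGHBOURHOOD of the CM point» (theory seat 3's
# `PerfectComplexDeformsOverEtaleNbhd`), the Hodge-theoretic spread being a KERNEL theorem — at any `Adm` (§1, §3), at the rank
# class (§2, TIER 2) and at the semiregularity class (§4, target seat 7's `sigmaAdmissible`)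

HONEST FRAMING. Lean index of the computation cell `pub-hsemireg` (seat p7, «assembly»). Nothing about any explicit variety is
asserted; every published input is a hypothesis BY NAME; the object and its numbers are BY VALUE from the census. Nothing here says
HC, HC_CM or HC_AV is proved; the g = 4 split case is IN PRINT ([Markman2023GeneralizedKummers] Thm. 1.5 (= Thm. 13.4; J. Eur. Math. Soc. 25 (2023) p. 236; pre-publication arXiv numbering: Thm. 1.3)) and is RE-DERIVED modulo the
named hypotheses. Theorems only: 0 `def`, 0 `sorry`, no new named fact, no decl of another seat touched.

## What this file changes in the Monday sentence (and nothing else)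

The g = 4 route-(C) theorems of `AmplificationChainG4RouteC.lean` / `AmplificationChainG4Transport.lean` / `PerfectComplexSigmaDoor.lean`
take the TRANSFER as ONE hypothesis BY NAME, `PerfectComplexVariationalHodge C Adm` (seat p4's door; `PerfectComplexRankTransfer C` at
`Adm := rankAdmissible C`, `PerfectComplexSigmaTransfer C` at `Adm := sigmaAdmissible`), which bundles (i) DEFORMATION THEORY — the
admissible complex `E₀` on the CM fibre extends to a perfect complex over a neighbourhood of `s₀` (on paper: [Lieblich2006] Thm. 4.2.1,
[Pridham2024Semiregularity] Cor. 2.25 / Rem. 2.27 / Rem. 2.21, [BuchweitzFlenner2003] Rem. 4.7 (1), [Deligne1968] Thm. 5.5, [EGAIV4]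
Cor. 17.16.3 (i), [ThomasonTrobaugh1990] 2.3.1 (d); OUTPUT SHAPE refereed-printed in the proof of [Perry2022] Prop. 8.1, arXiv p. 28
l. 38–40: «there exists a surjective étale morphism `U′ → U` with a point `0′ ↦ 0` such that `𝓜°_{U′} → U′` admits a section taking
`0′` to `E_{0′}`» — typed by theory seat 3 WITHOUT «surjective» and with only the classes `ch_p`, `p ∈ I`, of the extension pinned at
`t₀`: WEAKER than print as an assumption's conclusion) — with (ii) HODGE THEORY — `ch` of the extension on the nearby fibres is the
flat transport of `κ = ch(E₀)`, hence algebraic («hence `α_p(s) = ch_p(ℱ|X_s)` is algebraic for all `s` near `0`», BF's proof of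
Thm. 5.1, last sentence). Theory seat 3's `PerfectComplexChartSpread.lean` (p333379) SPLIT them: `PerfectComplexDeformsOverEtaleNbhd C Adm`
is (i) ALONE, in the printed étale shape, and (ii) is a KERNEL theorem (`….perfectComplexVariationalHodge` / `….perfectComplexRankTransfer`:
étale ⟹ smooth chart with a continuous section [SGA1 XII 3.1 (iii), tree theorem] ⟹ Ehresmann transport along the section ⟹ algebraic).
This file composes: every g = 4 form is restated with `hD : PerfectComplexDeformsOverEtaleNbhd C Adm` in place of `hT` and proved in
one line by feeding `hD.perfectComplexVariationalHodge` / `.perfectComplexRankTransfer` (§4: t-7's σ-door names directly).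

LOGIC, honestly: `hD ⟹ hT` is kernel, so each theorem below is FORMALLY A COROLLARY of its `hT`-form (it assumes more, not less); what
improves is WHERE the one un-linked assumption sits — at the end of the deformation theory, in a printed shape, with everything
Hodge-theoretic downstream kernel-checked — not the logical strength of the trust base (theory seat 3: «RELOCATION, not a weakening»;
lead R-74 (e)). WORDING RULE W-4 (red-5 v8 §23, whose tree probe V23–V25 kernel-checked the §2 compositions before this file): every
sentence prints BOTH names in the order «`hT` (consumed) ⟸ `hD` (assumed, printed étale SHAPE)»; `hT ⟹ hD` is NOT claimed (a
deformation of the OBJECT vs algebraicity of the CLASSES); `hT` remains the WEAKEST named input the g = 4 kernel sentence consumes,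
`hD` a SUFFICIENT one in the printed shape; never «`hT` derived» alone, never `hD` as «the printed theorem». WORDING RULE F-1 (red-5)
AT THE NEW LOCATION: THE KERNEL DOES NOT LINK `PerfectComplexDeformsOverEtaleNbhd C (rankAdmissible C)` (nor `… C sigmaAdmissible`) TO
PRIDHAM / PERRY / LIEBLICH; it is an assumption BY NAME, of printed SHAPE, whose CONTENT is on paper only (rank class:
[BuchweitzFlenner2008HH] Prop. 6.4.4 turns `rank Ext² ≤ r` into injectivity of `σ`, then (L1)–(L6) of `theory/TH2-ASSEMBLY-NOTE-2PAGE.md`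
§3; σ-class: (L1)–(L6) directly). F-3 (red-5): only the §3 forms of the transport file are used. The CHART shape (BF Thm. 5.1's own
output, a continuous — in particular holomorphic — section of the versal base, p. 179; red-2 v15) feeds every form likewise (§1 adapter).

* §1 schema (any `Adm`): `PerfectComplexDeformsOverEtaleNbhd.localVariationalHodgeFor` (+ chart twin; through it EVERY `LocalVariationalHodgeFor`
  consumer — seat p5's component statements, the Siegel chain — instantiates at the étale shape by dot notation);
  `splitHyperplane_…` (level `(N, d)`), `weilFourfoldsSplit_of_reach_of_deformsOverEtaleNbhd_of_hyperbolicSeedOn` / `…_of_complex`.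
* §2 TIER 2 (`rankAdmissible C`, every binder a real carrier): `weilFourfoldsSplit_of_reach_of_rankDeformsOverEtaleNbhd_of_hyperbolicSeedOn`
  / `_of_complex` / `_of_isMarkmanKappaShape` (seat p5) / `_of_extRank_eq` (red-5 V16) / `_of_local_ff_single` (THE MONDAY FORM = red-5 V25).
* §3 `𝒜_4` per Hodge-locus component: `PerfectComplexDeformsOverEtaleNbhd.hc_on_siegelFourfoldComponent_of_complex_of_baseChartAt`.
* §4 σ-TIER (`sigmaAdmissible`; theory seat 3's offer 2026-08-22T16:46:51Z): here the ONE assumption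
  `PerfectComplexDeformsOverEtaleNbhd C sigmaAdmissible` carries BOTH the printed OBJECT hypothesis (I-semiregular, `Ext^{<0} = 0`, simple:
  [BuchweitzFlenner2003] Thm. 5.1 / [Pridham2024Semiregularity] Cor. 2.25 + Rem. 2.27 / Perry 2026 Thm. 1.1 bullet 2, `B₀ = 0`) AND the
  printed CONCLUSION shape: `….perfectComplexRankTransfer_of_sigma` (TIER 2 = σ-tier + `himp` «rank clause ⟹ semiregular»,
  [BuchweitzFlenner2008HH] 6.4.4 as a hypothesis) and `weilFourfoldsSplit_of_reach_of_sigmaDeformsOverEtaleNbhd_of_complex` (the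
  σ-certificate census row, `hσ` BY VALUE). The dot-lemma `….perfectComplexSigmaTransfer` and the BUNDLED σ-consumers (g = 4 / g = 6) are
  target seat 7's `PerfectComplexSigmaLinks.lean` (dedup 16:59Z; neither file imports the other).

BY NAME after this file: reach (refereed, [Deligne1982HodgeCycles] proof of Thm. 4.8) and ONE of `PerfectComplexDeformsOverEtaleNbhd C
(rankAdmissible C)` / `… C sigmaAdmissible` (ASSUMPTION). BY VALUE: as in the transport file / the σ-door (`Φ`, model iso, `1`, `18 ≤ 18`
resp. `hσ`, Chern data (I3), hyperbolicity (I4)). NOT used anywhere: HC_CM, CM density / André–Oort, Mumford–Tate finiteness.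

References: [Perry2022] A. Perry, Compositio Math. 158 (2022), proof of Prop. 8.1 · [Lieblich2006] Thm. 4.2.1 ·
[Pridham2024Semiregularity] Forum Math. Sigma 12 (2024) e126, Cor. 2.25, Rem. 2.27, Rem. 2.21 · [BuchweitzFlenner2003] Compositio 137, Def.
4.1, Rem. 4.7 (1), §5 · [BuchweitzFlenner2008HH] Prop. 6.4.4 · [Deligne1968] Thm. 5.5 · [EGAIV4] Cor. 17.16.3 (i) · [ThomasonTrobaugh1990]
Prop. 2.3.1 (d) · [SGA1] XII 3.1 (iii) · [Markman2023GeneralizedKummers] JEMS 25 (2023) Thm. 1.5 (= Thm. 13.4), p. 236 (pre-publication arXiv numbering: Thm. 1.3) · [Orlov2002DerivedAbelian] Assertion 2.8 ·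
[GortzWedhorn2023] Thm. 22.42 · [Deligne1982HodgeCycles] proof of Thm. 4.8 · [Perry2026Semiregularity] arXiv:2604.00511 Thm. 1.1 (shape only).
-/

noncomputable section

open CategoryTheory AlgebraicGeometry Set
open Literature.AlgebraicGeometry.Motives Literature.AlgebraicGeometry.HodgeTheory
open Literature.AlgebraicGeometry.ModuliOfAbelianVarieties Literature.AlgebraicGeometry.Deligne1982
open Literature.AlgebraicGeometry.KTheory
open Literature.AlgebraicTopology.SingularHomology

namespace Summit.Ventures.HSemireg

local notation3 (prettyPrint := false) "Res[" f ", " s ", " k ", " A "]" =>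
  complexBetti.map (Literature.AlgebraicGeometry.Motives.fiberι f s) k A

open Summit.HodgeConjecture.HodgeConjecture
open Summit.HodgeConjecture.HodgeConjecture.WeilTypeLadder
open Summit.HodgeConjecture.HodgeConjecture.Cruxes.HodgeAbelianVarieties.EStepSecantInduction
open Summit.Ventures.HSemireg.GeneralStructure

/-! ## §1 Schema level (any admissibility notion `Adm`): the printed-shape assumption feeds the door-agnostic chain -/

section Schema

variable {C : ChernCharacterBetti} {Adm : AdmissibilityNotion}

/-- **The étale-neighbourhood deformation assumption IS a local variational statement for the perfect object class** (theory seat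
3's spread, then p4's door as the door-agnostic currency). [cite: Perry2022, proof of Prop. 8.1] [cite: BuchweitzFlenner2003, §5, proof of Thm. 5.1] -/
theorem PerfectComplexDeformsOverEtaleNbhd.localVariationalHodgeFor (hD : PerfectComplexDeformsOverEtaleNbhd C Adm) :
    LocalVariationalHodgeFor (perfectObjClass C Adm) :=
  hD.perfectComplexVariationalHodge.localVariationalHodgeFor

/-- The same from the CHART shape (BF Thm. 5.1's own output, p. 179: a continuous section). [cite: BuchweitzFlenner2003, §5, proof of Thm. 5.1] -/
theorem PerfectComplexDeformsOverSmoothChart.localVariationalHodgeFor (hD : PerfectComplexDeformsOverSmoothChart C Adm) :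
    LocalVariationalHodgeFor (perfectObjClass C Adm) :=
  hD.perfectComplexVariationalHodge.localVariationalHodgeFor

/-- **Route (C) at ONE level `(N, d)`, printed transfer shape**: Deligne's reach ∧ «admissible perfect complexes deform over an étale
neighbourhood» for `Adm` ∧ ONE hyperbolic seed of class `perfectObjClass C Adm` on a split `ℚ(√-d)`-Weil `2N`-fold ⟹ the Weil classes
of every SPLIT `ℚ(√-d)`-Weil `2N`-fold are algebraic. Schema in `Adm`; the kernel links `Adm` to no source (F-1).
[cite: Perry2022, proof of Prop. 8.1] [cite: Deligne1982HodgeCycles, proof of Thm. 4.8] [claim: Perry2026Semiregularity, status: under-review] -/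
theorem splitHyperplane_of_reach_of_deformsOverEtaleNbhd_of_hyperbolicSeedOn (hF : weilFamilyReach_hyperbolic)
    {N d : ℕ} (hN : 1 ≤ N) (hd : 0 < d) (hD : PerfectComplexDeformsOverEtaleNbhd C Adm)
    (hS : HasHyperbolicSeedOn (perfectObjClass C Adm) N d) : Stubs.WeilAlgebraicSplitHyperplane N d :=
  splitHyperplane_of_reach_of_perfectComplexVariationalHodge_of_hyperbolicSeedOn hF hN hd hD.perfectComplexVariationalHodge hS

/-- **g = 4, route (C), printed transfer shape — the cell's IN-TREE CONDITIONAL THEOREM, étale variant.** BY NAME: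
`weilFamilyReach_hyperbolic` (Deligne, refereed) and `PerfectComplexDeformsOverEtaleNbhd C Adm` (theory seat 3: an `Adm`-admissible bounded
complex of vector bundles on the fibre `X₀ ≅ 𝒳_{s₀}` of a smooth projective family over a smooth base, whose classes stay Hodge along `U`,
extends to a bounded complex of vector bundles on `𝒳 ×_S T` for some ÉTALE `T ⟶ S` and a point `t₀ ↦ s₀`, with the same `ch_p`, `p ∈ I`, on
the fibre over `t₀` — an ASSUMPTION, the conclusion shape printed in the proof of [Perry2022] Prop. 8.1; the kernel links it to nothing);
`0 < d`; ONE hyperbolic seed of class `perfectObjClass C Adm` on a split `ℚ(√-d)`-Weil fourfold (by value) ⟹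
`Stubs.WeilAlgebraicSplitHyperplane 2 d`: the Weil classes of EVERY abelian fourfold of the split `ℚ(√-d)`-Weil component are algebraic
(Markman's theorem for that component, re-derived; no new case). [cite: Perry2022, proof of Prop. 8.1]
[cite: Pridham2024Semiregularity, Cor. 2.25, Rem. 2.27] [cite: Lieblich2006, Thm. 4.2.1] [cite: Deligne1982HodgeCycles, proof of Thm. 4.8]
[cite: Markman2023GeneralizedKummers, Theorem 1.5 (= Theorem 13.4), p. 236 (the split fourfold case in print; arXiv:1805.11574 pre-publication numbering: Theorem 1.3)] [claim: Perry2026Semiregularity, status: under-review] -/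
theorem weilFourfoldsSplit_of_reach_of_deformsOverEtaleNbhd_of_hyperbolicSeedOn (hF : weilFamilyReach_hyperbolic)
    (hD : PerfectComplexDeformsOverEtaleNbhd C Adm) {d : ℕ} (hd : 0 < d) (hS : HasHyperbolicSeedOn (perfectObjClass C Adm) 2 d) :
    Stubs.WeilAlgebraicSplitHyperplane 2 d :=
  weilFourfoldsSplit_of_reach_of_perfectComplexVariationalHodge_of_hyperbolicSeedOn hF hD.perfectComplexVariationalHodge hd hS

/-- **g = 4, route (C), printed transfer shape, the census row UNBUNDLED** (every binder a real carrier except `hAdm : Adm (2·2) P.X I E`):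
the split CM anchor `(P, ψ₀, e, a)`, a non-zero rational `w` in the Weil plane, `I ∋ 2`, ONE admissible bounded complex of vector bundles
`E` with `ch₂(E) = q·h_K² + w`, `ch_p(E) = c_p·h_Kᵖ` off `2` ⟹ under reach and `PerfectComplexDeformsOverEtaleNbhd C Adm`,
`Stubs.WeilAlgebraicSplitHyperplane 2 d`. [cite: Perry2022, proof of Prop. 8.1] [cite: Deligne1982HodgeCycles, proof of Thm. 4.8]
[cite: Markman2023GeneralizedKummers, Theorem 1.5 (= Theorem 13.4), p. 236 (arXiv:1805.11574 pre-publication numbering: Theorem 1.3)] [claim: Perry2026Semiregularity, status: under-review] -/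
theorem weilFourfoldsSplit_of_reach_of_deformsOverEtaleNbhd_of_complex (hF : weilFamilyReach_hyperbolic)
    (hD : PerfectComplexDeformsOverEtaleNbhd C Adm) {d : ℕ} (hd : 0 < d)
    (P : AbelianVariety ℂ) (ψ₀ : P ⟶ P) (e : ProjectiveEmbedding P.X) (a : complexBetti (projectiveSpace e.n ℂ) 2)
    (hP : P.dim = 2 * 2) (hψ : ψ₀ ≫ ψ₀ = -(d • 𝟙 P)) (ha : IsRationalClass a) (ha0 : a ≠ 0)
    (hhyp : IsHyperbolicWeilType P ψ₀ 2 (symmetrisedClass d P ψ₀ e a))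
    (w : complexBetti P.X (2 * 2)) (hwW : w ∈ weilClassesOf P ψ₀ 2 d) (hwr : IsRationalClass w) (hw0 : w ≠ 0)
    (I : Finset ℕ) (h2 : 2 ∈ I) (E : CochainComplex P.X.left.Modules ℤ) (hE : IsBoundedVBComplex E)
    (hAdm : Adm (2 * 2) P.X I E) (q : ℚ) (c : ℕ → ℚ)
    (hch2 : chPerfect C P.X E hE.isFiniteLocallyFree 2 = ((q : ℚ) : ℂ) • cupPowTwo (symmetrisedClass d P ψ₀ e a) 2 + w)
    (hchp : ∀ p ∈ I, p ≠ 2 →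
      chPerfect C P.X E hE.isFiniteLocallyFree p = ((c p : ℚ) : ℂ) • cupPowTwo (symmetrisedClass d P ψ₀ e a) p) :
    Stubs.WeilAlgebraicSplitHyperplane 2 d :=
  weilFourfoldsSplit_of_reach_of_perfectComplexVariationalHodge_of_complex hF hD.perfectComplexVariationalHodge hd P ψ₀ e a hP hψ
    ha ha0 hhyp w hwW hwr hw0 I h2 E hE hAdm q c hch2 hchp

end Schema

/-! ## §2 TIER 2 — `Adm := rankAdmissible C` (seat p4's REAL rank class «`{1..n} ⊆ I`, `Ext^{<0} = 0`, `Hom = ℂ`, `rank Ext² ≤ r(A, ch E)`»,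
printed strength ON PAPER via [BuchweitzFlenner2008HH] Prop. 6.4.4); `PerfectComplexDeformsOverEtaleNbhd C (rankAdmissible C)` is an
ASSUMPTION BY NAME which the kernel links to no source (F-1 once for §2). -/

section TierTwo

variable {C : ChernCharacterBetti}

/-- **g = 4, route (C), TIER 2, printed transfer shape — bundled seed.** BY NAME: reach (refereed) and
`PerfectComplexDeformsOverEtaleNbhd C (rankAdmissible C)` (ASSUMPTION, printed shape); `0 < d`; ONE hyperbolic seed of class `rankObjClass C`
on a split `ℚ(√-d)`-Weil fourfold (by value) ⟹ `Stubs.WeilAlgebraicSplitHyperplane 2 d`. [cite: BuchweitzFlenner2008HH, Prop. 6.4.4]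
[cite: Perry2022, proof of Prop. 8.1] [cite: Markman2023GeneralizedKummers, Theorem 1.5 (= Theorem 13.4), p. 236 (arXiv:1805.11574 pre-publication numbering: Theorem 1.3)] [claim: Perry2026Semiregularity, status: under-review] -/
theorem weilFourfoldsSplit_of_reach_of_rankDeformsOverEtaleNbhd_of_hyperbolicSeedOn (hF : weilFamilyReach_hyperbolic)
    (hD : PerfectComplexDeformsOverEtaleNbhd C (rankAdmissible C)) {d : ℕ} (hd : 0 < d)
    (hS : HasHyperbolicSeedOn (rankObjClass C) 2 d) : Stubs.WeilAlgebraicSplitHyperplane 2 d :=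
  weilFourfoldsSplit_of_reach_of_perfectComplexRankTransfer_of_hyperbolicSeedOn hF hD.perfectComplexRankTransfer hd hS

/-- **g = 4, route (C), TIER 2, printed transfer shape, the census row UNBUNDLED — every binder a real tree carrier.** The split CM
anchor `(P, ψ₀, e, a)`; a non-zero rational `w` in the Weil plane; `I ⊇ {1,2,3,4}`; ONE bounded complex of vector bundles `E` on `P.X`
with `Ext^{<0}(E,E) = 0`, `Hom(E,E) = ℂ`, `rank Ext²(E,E) ≤ r(P, ch E)` (`extRank`, `contractionRank`); `ch₂(E) = q·h_K² + w`,
`ch_p(E) = c_p·h_Kᵖ` off `2` ⟹ under reach and the ASSUMPTION `PerfectComplexDeformsOverEtaleNbhd C (rankAdmissible C)`, the Weil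
classes of EVERY split `√-d`-Weil abelian fourfold are algebraic. STEP-0 object by value: `P = X × X̂`, `E = Φ(I_{p×X ∪ X×q}) ⊗ M_B`,
`Ext^• = (1,8,18,8,1)`, `r = 18`, `d ∈ {3,7,11,15}`. [cite: BuchweitzFlenner2008HH, Prop. 6.4.4] [cite: Perry2022, proof of Prop. 8.1]
[cite: Deligne1982HodgeCycles, proof of Thm. 4.8] [cite: Markman2023GeneralizedKummers, Theorem 1.5 (= Theorem 13.4), p. 236 (arXiv:1805.11574 pre-publication numbering: Theorem 1.3)] [claim: Perry2026Semiregularity, status: under-review] -/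
theorem weilFourfoldsSplit_of_reach_of_rankDeformsOverEtaleNbhd_of_complex (hF : weilFamilyReach_hyperbolic)
    (hD : PerfectComplexDeformsOverEtaleNbhd C (rankAdmissible C)) {d : ℕ} (hd : 0 < d)
    (P : AbelianVariety ℂ) (ψ₀ : P ⟶ P) (e : ProjectiveEmbedding P.X) (a : complexBetti (projectiveSpace e.n ℂ) 2)
    (hP : P.dim = 2 * 2) (hψ : ψ₀ ≫ ψ₀ = -(d • 𝟙 P)) (ha : IsRationalClass a) (ha0 : a ≠ 0)
    (hhyp : IsHyperbolicWeilType P ψ₀ 2 (symmetrisedClass d P ψ₀ e a))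
    (w : complexBetti P.X (2 * 2)) (hwW : w ∈ weilClassesOf P ψ₀ 2 d) (hwr : IsRationalClass w) (hw0 : w ≠ 0)
    (I : Finset ℕ) (hI : ∀ p : ℕ, 1 ≤ p → p ≤ 2 * 2 → p ∈ I) (E : CochainComplex P.X.left.Modules ℤ) (hE : IsBoundedVBComplex E)
    (hneg : ∀ k : ℤ, k < 0 → extRank P.X E k = 0) (h0 : extRank P.X E 0 = 1)
    (h2 : extRank P.X E 2 ≤ Cardinal.lift.{1} (contractionRank P fun p ↦ chPerfect C P.X E hE.isFiniteLocallyFree p))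
    (q : ℚ) (c : ℕ → ℚ)
    (hch2 : chPerfect C P.X E hE.isFiniteLocallyFree 2 = ((q : ℚ) : ℂ) • cupPowTwo (symmetrisedClass d P ψ₀ e a) 2 + w)
    (hchp : ∀ p ∈ I, p ≠ 2 →
      chPerfect C P.X E hE.isFiniteLocallyFree p = ((c p : ℚ) : ℂ) • cupPowTwo (symmetrisedClass d P ψ₀ e a) p) :
    Stubs.WeilAlgebraicSplitHyperplane 2 d :=
  weilFourfoldsSplit_of_reach_of_perfectComplexRankTransfer_of_complex hF hD.perfectComplexRankTransfer hd P ψ₀ e a hP hψ ha ha0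
    hhyp w hwW hwr hw0 I hI E hE hneg h0 h2 q c hch2 hchp

/-- **TIER 2 × Markman's class shape (seat p5's `IsMarkmanKappaShape`) × printed transfer shape**: inputs literally the census
certificate — (I1)+(I2-β) = `hAdm`, (I3) = `hκ`, (I4) = `hhyp` — and the one un-linked assumption the printed-shape deformation statement.
[cite: BuchweitzFlenner2008HH, Prop. 6.4.4] [cite: Markman2025SecantWeil, Cor. 1.3.2 and Thm. 1.4.1 (4) (preprint)]
[cite: Perry2022, proof of Prop. 8.1] [cite: Markman2023GeneralizedKummers, Theorem 1.5 (= Theorem 13.4), p. 236 (arXiv:1805.11574 pre-publication numbering: Theorem 1.3)] [claim: Perry2026Semiregularity, status: under-review] -/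
theorem weilFourfoldsSplit_of_reach_of_rankDeformsOverEtaleNbhd_of_isMarkmanKappaShape (hF : weilFamilyReach_hyperbolic)
    (hD : PerfectComplexDeformsOverEtaleNbhd C (rankAdmissible C)) {d : ℕ} (hd : 0 < d)
    (P : AbelianVariety ℂ) (ψ₀ : P ⟶ P) (e : ProjectiveEmbedding P.X) (a : complexBetti (projectiveSpace e.n ℂ) 2)
    (hP : P.dim = 2 * 2) (hψ : ψ₀ ≫ ψ₀ = -(d • 𝟙 P)) (ha : IsRationalClass a) (ha0 : a ≠ 0)
    (hhyp : IsHyperbolicWeilType P ψ₀ 2 (symmetrisedClass d P ψ₀ e a)) {w : complexBetti P.X (2 * 2)} {I : Finset ℕ}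
    (h2 : 2 ∈ I) (E : CochainComplex P.X.left.Modules ℤ) (hE : IsBoundedVBComplex E) (hAdm : rankAdmissible C (2 * 2) P.X I E)
    (hκ : IsMarkmanKappaShape 2 d P ψ₀ (symmetrisedClass d P ψ₀ e a) I (fun p ↦ chPerfect C P.X E hE.isFiniteLocallyFree p) w) :
    Stubs.WeilAlgebraicSplitHyperplane 2 d :=
  weilFourfoldsSplit_of_reach_of_perfectComplexRankTransfer_of_isMarkmanKappaShape hF hD.perfectComplexRankTransfer hd P ψ₀ e a
    hP hψ ha ha0 hhyp h2 E hE hAdm hκ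

/-- **g = 4, TIER 2, printed transfer shape — FUNCTOR-FREE form** (red-5 V16): the census-row conclusion from the bare `Ext`-rank
equalities `extRank A₀ E n = extRank Y₀ G n` for `n ≤ 2` plus the three `Ext` clauses on the SOURCE `G`; transfer =
`PerfectComplexDeformsOverEtaleNbhd C (rankAdmissible C)` BY NAME. [cite: Markman2023GeneralizedKummers, Theorem 1.5 (= Theorem 13.4), p. 236 (the case in print; arXiv:1805.11574 pre-publication numbering: Theorem 1.3)]
[cite: BuchweitzFlenner2008HH, Prop. 6.4.4] [cite: Perry2022, proof of Prop. 8.1] -/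
theorem weilFourfoldsSplit_of_reach_of_rankDeformsOverEtaleNbhd_of_extRank_eq (hF : weilFamilyReach_hyperbolic)
    (hD : PerfectComplexDeformsOverEtaleNbhd C (rankAdmissible C)) {d : ℕ} (hd : 0 < d)
    (P : AbelianVariety ℂ) (ψ₀ : P ⟶ P) (e : ProjectiveEmbedding P.X) (a : complexBetti (projectiveSpace e.n ℂ) 2)
    (hP : P.dim = 2 * 2) (hψ : ψ₀ ≫ ψ₀ = -(d • 𝟙 P)) (ha : IsRationalClass a) (ha0 : a ≠ 0)
    (hhyp : IsHyperbolicWeilType P ψ₀ 2 (symmetrisedClass d P ψ₀ e a))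
    (w : complexBetti P.X (2 * 2)) (hwW : w ∈ weilClassesOf P ψ₀ 2 d) (hwr : IsRationalClass w) (hw0 : w ≠ 0)
    (I : Finset ℕ) (hI : ∀ p : ℕ, 1 ≤ p → p ≤ 2 * 2 → p ∈ I) (E : CochainComplex P.X.left.Modules ℤ)
    (hE : IsBoundedVBComplex E) (q : ℚ) (c : ℕ → ℚ)
    (hch2 : chPerfect C P.X E hE.isFiniteLocallyFree 2 = ((q : ℚ) : ℂ) • cupPowTwo (symmetrisedClass d P ψ₀ e a) 2 + w)
    (hchp : ∀ p ∈ I, p ≠ 2 →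
      chPerfect C P.X E hE.isFiniteLocallyFree p = ((c p : ℚ) : ℂ) • cupPowTwo (symmetrisedClass d P ψ₀ e a) p)
    {Y₀ : SchemeOver ℂ} (G : CochainComplex Y₀.left.Modules ℤ)
    (hext : ∀ n : ℤ, n ≤ 2 → extRank P.X E n = extRank Y₀ G n)
    (hneg : ∀ k : ℤ, k < 0 → extRank Y₀ G k = 0) (h0 : extRank Y₀ G 0 = 1)
    (h2 : extRank Y₀ G 2 ≤ Cardinal.lift.{1} (contractionRank P fun p ↦ chPerfect C P.X E hE.isFiniteLocallyFree p)) :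
    Stubs.WeilAlgebraicSplitHyperplane 2 d :=
  weilFourfoldsSplit_of_reach_of_perfectComplexRankTransfer_of_extRank_eq hF hD.perfectComplexRankTransfer hd P ψ₀ e a hP hψ ha
    ha0 hhyp w hwW hwr hw0 I hI E hE q c hch2 hchp G hext hneg h0 h2

/-- **g = 4, TIER 2, printed transfer shape — THE MONDAY FORM: SHEAF source, LOCAL full faithfulness** (red-5 V17b; = red-5's V25).
The census row with `G = G₀[0]` a sheaf (`G₀ = I_Z`, `Z = p×X ∪ X×q ⊂ X × X`, by value), `Φ` a `ℂ`-linear additive shift-commuting functor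
on `D(Mod 𝒪)` with `Φ(Q G₀[0]) ≅ Q E` and `Φ.map` BIJECTIVE on the self-Homs of `Q G₀[0]` in degrees `n ≤ 2` (what Orlov's `D^b(Coh)`
equivalence + [GortzWedhorn2023] Thm. 22.42 give for coherent `G₀`; BY VALUE), `extRank Y₀ G₀[0] 0 = 1` («`I_Z` simple»),
`extRank Y₀ G₀[0] 2 ≤ r` («`18 ≤ 18`»); `Ext^{<0} = 0` discharged for a sheaf. BY NAME: `weilFamilyReach_hyperbolic` (refereed) and — in
place of the CONSUMED `hT : PerfectComplexRankTransfer C` (kernel-derived from `hD`; `hT ⟹ hD` not claimed, W-4) — the ASSUMPTION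
`hD : PerfectComplexDeformsOverEtaleNbhd C (rankAdmissible C)` (rank-admissible complexes on the CM fibre, Hodge along `U`, deform as bounded
complexes of vector bundles over an ÉTALE neighbourhood of `s₀` with the same `ch_p`, `p ∈ I`, at the marked point — printed shape
[Perry2022] proof of Prop. 8.1; content on paper; kernel-linked to nothing, F-1). Conclusion: `Stubs.WeilAlgebraicSplitHyperplane 2 d`
(in print: [Markman2023GeneralizedKummers] Thm. 1.5 (= Thm. 13.4; J. Eur. Math. Soc. 25 (2023) p. 236; pre-publication arXiv numbering: Thm. 1.3); re-derived). [cite: Markman2023GeneralizedKummers, Theorem 1.5 (= Theorem 13.4), p. 236 (the case in print; arXiv:1805.11574 pre-publication numbering: Theorem 1.3)]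
[cite: Perry2022, proof of Prop. 8.1] [cite: Orlov2002DerivedAbelian, Assertion 2.8] [cite: GortzWedhorn2023, Thm. 22.42]
[cite: BuchweitzFlenner2008HH, Prop. 6.4.4] [claim: Perry2026Semiregularity, status: under-review] -/
theorem weilFourfoldsSplit_of_reach_of_rankDeformsOverEtaleNbhd_of_local_ff_single (hF : weilFamilyReach_hyperbolic)
    (hD : PerfectComplexDeformsOverEtaleNbhd C (rankAdmissible C)) {d : ℕ} (hd : 0 < d)
    (P : AbelianVariety ℂ) (ψ₀ : P ⟶ P) (e : ProjectiveEmbedding P.X) (a : complexBetti (projectiveSpace e.n ℂ) 2)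
    (hP : P.dim = 2 * 2) (hψ : ψ₀ ≫ ψ₀ = -(d • 𝟙 P)) (ha : IsRationalClass a) (ha0 : a ≠ 0)
    (hhyp : IsHyperbolicWeilType P ψ₀ 2 (symmetrisedClass d P ψ₀ e a))
    (w : complexBetti P.X (2 * 2)) (hwW : w ∈ weilClassesOf P ψ₀ 2 d) (hwr : IsRationalClass w) (hw0 : w ≠ 0)
    (I : Finset ℕ) (hI : ∀ p : ℕ, 1 ≤ p → p ≤ 2 * 2 → p ∈ I) (E : CochainComplex P.X.left.Modules ℤ)
    (hE : IsBoundedVBComplex E) (q : ℚ) (c : ℕ → ℚ)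
    (hch2 : chPerfect C P.X E hE.isFiniteLocallyFree 2 = ((q : ℚ) : ℂ) • cupPowTwo (symmetrisedClass d P ψ₀ e a) 2 + w)
    (hchp : ∀ p ∈ I, p ≠ 2 →
      chPerfect C P.X E hE.isFiniteLocallyFree p = ((c p : ℚ) : ℂ) • cupPowTwo (symmetrisedClass d P ψ₀ e a) p)
    {Y₀ : SchemeOver ℂ} (G₀ : Y₀.left.Modules) :
    letI := HasDerivedCategory.standard Y₀.left.Modules
    letI := HasDerivedCategory.standard P.X.left.Modules
    ∀ (Φ : DerivedCategory Y₀.left.Modules ⥤ DerivedCategory P.X.left.Modules) [Φ.Additive] [Φ.Linear ℂ]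
      [Φ.CommShift ℤ]
      (_ : Φ.obj (DerivedCategory.Q.obj ((CochainComplex.singleFunctor Y₀.left.Modules 0).obj G₀)) ≅
        DerivedCategory.Q.obj E),
      (∀ n : ℤ, n ≤ 2 → Function.Bijective
        (fun f : (DerivedCategory.Q.obj ((CochainComplex.singleFunctor Y₀.left.Modules 0).obj G₀) ⟶
          (DerivedCategory.Q.obj ((CochainComplex.singleFunctor Y₀.left.Modules 0).obj G₀))⟦n⟧) ↦ Φ.map f)) →
      extRank Y₀ ((CochainComplex.singleFunctor Y₀.left.Modules 0).obj G₀) 0 = 1 →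
      extRank Y₀ ((CochainComplex.singleFunctor Y₀.left.Modules 0).obj G₀) 2 ≤
        Cardinal.lift.{1} (contractionRank P fun p ↦ chPerfect C P.X E hE.isFiniteLocallyFree p) →
      Stubs.WeilAlgebraicSplitHyperplane 2 d :=
  weilFourfoldsSplit_of_reach_of_perfectComplexRankTransfer_of_local_ff_single hF hD.perfectComplexRankTransfer hd P ψ₀ e a hP
    hψ ha ha0 hhyp w hwW hwr hw0 I hI E hE q c hch2 hchp G₀

end TierTwo

/-! ## §3 `𝒜_4` per Hodge-locus component: the coordinator's sentence at the printed transfer shape -/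

section Siegel

variable {C : ChernCharacterBetti} {Adm : AdmissibilityNotion} {δ : Fin 4 → ℕ} {N : ℕ}

/-- **g = 4, route (C), per Hodge-locus component of `𝒜_{4,δ,N}`, printed transfer shape** («an admissible representative at ONE point
of a Hodge-locus component, deforming over an étale neighbourhood, ⟹ the class is algebraic at EVERY point of THAT component»): the
`𝒜_4` form of `AmplificationChainG4RouteC.lean` §4 fed by `hD`; base chart at `C'` and `deligne_globalInvariantCycles` BY NAME; model,
complex and Chern data BY VALUE. Schema in `Adm` (F-1). [cite: Perry2022, proof of Prop. 8.1] [cite: DeligneHodgeII1971, Théorème 4.1.1]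
[cite: CattaniDeligneKaplan1995JAMS, Thm. 1.1 and Cor. 1.2] [claim: Perry2026Semiregularity, status: under-review] -/
theorem PerfectComplexDeformsOverEtaleNbhd.hc_on_siegelFourfoldComponent_of_complex_of_baseChartAt
    (hD : PerfectComplexDeformsOverEtaleNbhd C Adm) {D : SiegelModuliDatum 4 δ N} {C' : HodgeLocusComponent D.f 4 2}
    (hS : SiegelHodgeLocusBaseChartAt D 2 C') (hGIC : deligne_globalInvariantCycles) (I : Finset ℕ) (h2 : 2 ∈ I)
    (Λ : (p' : ℕ) → complexBetti D.𝒳 (2 * p'))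
    (hΛ : ∀ p' ∈ I, ∀ s : ComplexPoints D.S, IsOfHodgeType 4 (fiberOver D.f s) (2 * p') p' p' (Res[D.f, s, 2 * p', Λ p']))
    (hΛ2 : ∀ s : ComplexPoints D.S, IsRationalClass (Res[D.f, s, 2 * 2, Λ 2]) ∧
      Res[D.f, s, 2 * 2, Λ 2] ∈ algebraicClasses (fiberOver D.f s) 2)
    {x₀ : FiberClass D.f (2 * 2)} (hx₀ : x₀ ∈ C'.carrier) (a b : ℚ) (ha : a ≠ 0) (c : ℕ → ℚ)
    (X₀ : SchemeOver ℂ) (e : X₀ ≅ fiberOver D.f x₀.pt)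
    (E : CochainComplex X₀.left.Modules ℤ) (hE : IsBoundedVBComplex E) (hAdm : Adm 4 X₀ I E)
    (hch2 : chPerfect C X₀ E hE.isFiniteLocallyFree 2 =
      complexBetti.map e.hom (2 * 2) ((a : ℂ) • x₀.cls + (b : ℂ) • Res[D.f, x₀.pt, 2 * 2, Λ 2]))
    (hchp' : ∀ p' ∈ I, p' ≠ 2 → chPerfect C X₀ E hE.isFiniteLocallyFree p' =
      complexBetti.map e.hom (2 * p') (((c p' : ℚ) : ℂ) • Res[D.f, x₀.pt, 2 * p', Λ p'])) :
    ∀ x ∈ C'.carrier, x.cls ∈ algebraicClasses (fiberOver D.f x.pt) 2 :=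
  hD.perfectComplexVariationalHodge.hc_on_siegelFourfoldComponent_of_complex_of_baseChartAt hS hGIC I h2 Λ hΛ hΛ2 hx₀ a b ha c
    X₀ e E hE hAdm hch2 hchp'

end Siegel

/-! ## §4 σ-TIER — `Adm := sigmaAdmissible` (target seat 7's REAL semiregularity class «`{1..n} ⊆ I`, `Ext^{<0}(E,E) = 0`, `Hom(E,E) = ℂ`,
`E` strictly perfect in `[a, b]`, `(σ_q)_{q+1 ∈ I}` JOINTLY INJECTIVE on `Ext²(E•,E•)`», `HomComplex.IsISemiregularC` — the OBJECT hypothesis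
printed in [BuchweitzFlenner2003] Thm. 5.1 (sheaves) / [Pridham2024Semiregularity] Cor. 2.25 + Rem. 2.27 / Perry 2026 Thm. 1.1, `B₀ = 0`):
ONE assumption carrying BOTH the printed object hypothesis and the printed conclusion shape. `PerfectComplexDeformsOverEtaleNbhd C
sigmaAdmissible` is an ASSUMPTION BY NAME which the kernel links to no source (F-1 once for §4); on paper (L1)–(L6) + atlas + étale
quasi-section + strictification, NO [BuchweitzFlenner2008HH] 6.4.4 step. DEDUP (bus 2026-08-22T16:59Z, th-3 / th-2 / t-7 / p7): the dot-lemma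
`PerfectComplexDeformsOverEtaleNbhd.perfectComplexSigmaTransfer` (+ chart twin) and the BUNDLED g = 4 / g = 6 σ-consumers live in target
seat 7's `PerfectComplexSigmaLinks.lean` (#7a); this § keeps only what is not there — the `himp` bookkeeping and the UNBUNDLED σ-certificate
g = 4 row — written directly over target seat 7's door names, so that neither file imports the other. -/

section SigmaTier

variable {C : ChernCharacterBetti}

/-- **TIER 2 = σ-tier + «rank clause ⟹ semiregular».** Étale shape at the σ-class and the HYPOTHESIS `himp : rankAdmissible ⟹
sigmaAdmissible` (on paper [BuchweitzFlenner2008HH] Prop. 6.4.4, `σ_F(c_F ξ) = ξ ⌟ ch F`, with the squeeze `r ≤ rank σ ≤ rank Ext² ≤ r`;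
not a kernel statement — target seat 7's factorisation `perfectComplexRankTransfer_of_sigmaTransfer`) ⟹ seat p4's rank transfer
`PerfectComplexRankTransfer C` (consumed by every §2 form). So the TIER-2 assumption of record IS IMPLIED BY (one direction; the
converse is not in the tree and not claimed — red-5 W-5) a printed-shape deformation statement on a real `σ`-carrier AND a printed
identity on the same carrier; W-4 / F-1 at both. [cite: BuchweitzFlenner2008HH, Prop. 6.4.4]
[cite: Perry2022, proof of Prop. 8.1] [cite: Pridham2024Semiregularity, Cor. 2.25, Rem. 2.27] -/
theorem PerfectComplexDeformsOverEtaleNbhd.perfectComplexRankTransfer_of_sigma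
    (hD : PerfectComplexDeformsOverEtaleNbhd C sigmaAdmissible)
    (himp : ∀ n X₀ I E, rankAdmissible C n X₀ I E → sigmaAdmissible n X₀ I E) : PerfectComplexRankTransfer C :=
  perfectComplexRankTransfer_of_sigmaTransfer himp ((perfectComplexSigmaTransfer_iff C).2 hD.perfectComplexVariationalHodge)

/-- **g = 4, route (C), σ-TIER, printed transfer shape, the census row UNBUNDLED over the σ-CERTIFICATE — every binder a real tree
carrier.** The split CM anchor `(P, ψ₀, e, a)`; a non-zero rational `w` in the Weil plane; `I ⊇ {1,2,3,4}`; ONE bounded complex of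
vector bundles `E` on `P.X` in `[a', b']` with `Ext^{<0}(E,E) = 0`, `Hom(E,E) = ℂ` and `(σ_q(E))_{q+1 ∈ I}` JOINTLY INJECTIVE (`hσ`, BY
VALUE: the census certificate «σ-rank = dim Ext² = 18 on two codes»; no kernel computation discharges it); `ch₂(E) = q·h_K² + w`,
`ch_p(E) = c_p·h_Kᵖ` off `2` ⟹ under `weilFamilyReach_hyperbolic` (refereed) and the ONE ASSUMPTION
`PerfectComplexDeformsOverEtaleNbhd C sigmaAdmissible` («I-semiregular strictly perfect simple complexes with `Ext^{<0} = 0` on the CM fibre of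
a smooth projective family, Hodge along `U`, deform as bounded complexes of vector bundles over an ÉTALE neighbourhood of `s₀` with the same
`ch|_I` at the marked point» — printed OBJECT hypothesis, printed CONCLUSION shape [Perry2022, proof of Prop. 8.1]; content on paper
(L1)–(L6); kernel-linked to nothing, F-1), the Weil classes of EVERY split `√-d`-Weil abelian fourfold are algebraic:
`Stubs.WeilAlgebraicSplitHyperplane 2 d` (in print, [Markman2023GeneralizedKummers] Thm. 1.5 (= Thm. 13.4; J. Eur. Math. Soc. 25 (2023) p. 236; pre-publication arXiv numbering: Thm. 1.3); re-derived). Target seat 7's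
`weilFourfoldsSplit_of_reach_of_perfectComplexSigmaTransfer_of_complex` with `hT : PerfectComplexSigmaTransfer C` consumed ⟸ `hD` assumed
(W-4: `hD ⟹ hT` kernel via theory seat 3's spread, `hT ⟹ hD` not claimed). For the STEP-0 object by value: `P = X × X̂`,
`E = Φ(I_{p×X ∪ X×q}) ⊗ M_B`, `Ext^• = (1,8,18,8,1)`, full `σ` injective (`28 = 6 + 16 + 6`), `d ∈ {3,7,11,15}`.
[cite: Perry2022, proof of Prop. 8.1] [cite: Pridham2024Semiregularity, Cor. 2.25, Rem. 2.27] [cite: Lieblich2006, Thm. 4.2.1]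
[cite: BuchweitzFlenner2003, Def. 4.1 and §5 (I-semiregular)] [cite: Deligne1982HodgeCycles, proof of Thm. 4.8]
[cite: Markman2025SecantWeil, §1.5 and Thm. 1.5.1 (preprint)] [cite: Markman2023GeneralizedKummers, Theorem 1.5 (= Theorem 13.4), p. 236 (arXiv:1805.11574 pre-publication numbering: Theorem 1.3)]
[claim: Perry2026Semiregularity, status: under-review] -/
theorem weilFourfoldsSplit_of_reach_of_sigmaDeformsOverEtaleNbhd_of_complex (hF : weilFamilyReach_hyperbolic)
    (hD : PerfectComplexDeformsOverEtaleNbhd C sigmaAdmissible) {d : ℕ} (hd : 0 < d)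
    (P : AbelianVariety ℂ) (ψ₀ : P ⟶ P) (e : ProjectiveEmbedding P.X) (a : complexBetti (projectiveSpace e.n ℂ) 2)
    (hP : P.dim = 2 * 2) (hψ : ψ₀ ≫ ψ₀ = -(d • 𝟙 P)) (ha : IsRationalClass a) (ha0 : a ≠ 0)
    (hhyp : IsHyperbolicWeilType P ψ₀ 2 (symmetrisedClass d P ψ₀ e a))
    (w : complexBetti P.X (2 * 2)) (hwW : w ∈ weilClassesOf P ψ₀ 2 d) (hwr : IsRationalClass w) (hw0 : w ≠ 0)
    (I : Finset ℕ) (hI : ∀ p : ℕ, 1 ≤ p → p ≤ 2 * 2 → p ∈ I) (E : CochainComplex P.X.left.Modules ℤ)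
    (hE : IsBoundedVBComplex E) (hneg : ∀ k : ℤ, k < 0 → extRank P.X E k = 0) (h0 : extRank P.X E 0 = 1)
    (a' b' : ℤ) [E.IsStrictlyGE a'] [E.IsStrictlyLE b']
    (hσ : letI := HasDerivedCategory.standard P.X.left.Modules
      HomComplex.IsISemiregularC P.X E a' b' hE.isFiniteLocallyFree {q | q + 1 ∈ I})
    (q : ℚ) (c : ℕ → ℚ)
    (hch2 : chPerfect C P.X E hE.isFiniteLocallyFree 2 = ((q : ℚ) : ℂ) • cupPowTwo (symmetrisedClass d P ψ₀ e a) 2 + w)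
    (hchp : ∀ p ∈ I, p ≠ 2 →
      chPerfect C P.X E hE.isFiniteLocallyFree p = ((c p : ℚ) : ℂ) • cupPowTwo (symmetrisedClass d P ψ₀ e a) p) :
    Stubs.WeilAlgebraicSplitHyperplane 2 d :=
  weilFourfoldsSplit_of_reach_of_perfectComplexSigmaTransfer_of_complex hF
    ((perfectComplexSigmaTransfer_iff C).2 hD.perfectComplexVariationalHodge) hd P ψ₀ e a hP hψ ha ha0 hhyp w hwW hwr hw0 I hI E hE
    hneg h0 a' b' hσ q c hch2 hchp

end SigmaTier

/-! ## Audit: nothing is decided here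
Every theorem above carries the transfer assumption `PerfectComplexDeformsOverEtaleNbhd C Adm` (printed étale SHAPE; `Adm` a schema,
`rankAdmissible C` or `sigmaAdmissible`; one schema-level chart twin) AND a seed of the corresponding class (by value), next to the refereed reach fact /
the `𝒜_4` chart clauses BY NAME; each is formally a COROLLARY of its `hT`-form through theory seat 3's kernel spread theorem. The kernel
links no `Adm`, nor the deformation assumption, nor `himp`, to Pridham / Perry / Lieblich / BF. `HC_CM`, CM density, Mumford–Tate
finiteness, Grothendieck existence do not occur. No definition, no named fact. -/

end Summit.Ventures.HSemireg

end
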